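import Summits.Schanuel.Schanuel.Theorems.DiophantineDichotomyApproximationPropertyHighSatelliteLemmas
import Summits.Schanuel.Schanuel.Theorems.DiophantineDichotomyApproximationPropertyPointDatumOfCloseZero
import Summits.Schanuel.Schanuel.Theorems.DiophantineDichotomyApproximationPropertyExistsPrimeFactorMem
import Summits.Schanuel.Schanuel.Theorems.DiophantineDichotomyApproximationPropertyBoxModIdeal
import Summits.Schanuel.Schanuel.Theorems.DiophantineDichotomyApproximationPropertySmallPrimeHypersurface
import Summits.Schanuel.Schanuel.Theorems.DiophantineDichotomyApproximationPropertyCycleAPIAt3GlueLemmas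
import Summits.Schanuel.Schanuel.Theorems.DiophantineDichotomyApproximationPropertyZeroDimDictionary
import Literature.NumberTheory.Transcendental.NesterenkoEliminationProp411Holds
import Literature.NumberTheory.Transcendental.PhilipponCriterionProjDist
import Literature.RingTheory.MvPolynomial.HomogeneousDimension
import HarnessLib

/-!
# Stub `pointDatum_or_lowSurface3` of line `orbit-interpolation-determinant` (crux `ApproximationProperty`, stmt-Schanuel-6117) — datum, or the satellite lies on a LOW-DEGREE surface

Route `DiophantineDichotomy` (sub-problem `Schanuel/Schanuel`), crux
`Summit.Schanuel.Schanuel.Theses.DiophantineDichotomy.ApproximationProperty` (stmt-Schanuel-6117), line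
`orbit-interpolation-determinant`, skeleton v26 (lead `prover-line-stmt-Schanuel-6117-c12-0`), registered stub
`pointDatum_or_lowSurface3` (KERNEL-c12.md §6(a)): step 1 of the high-satellite lever (…HighSatelliteOf.lean, p154175) run
at degree `d = ⌊Δ/M₁⌋` for an ARBITRARY constant `M₁ ≥ 64c₁`, WITHOUT any hypothesis on the degree of the satellite. For a
datum of the clause-free descent at `(Δ, 8Y)` whose orbit `𝔭` lies on a satellite `𝔮'` (prime of rank `2`, `𝔮' ≤ 𝔭`)
enveloping it at level `⌊C₄Δ⌋`: EITHER a `PointAPAbsAt 3`-datum at `(Δ, Y)`, OR a non-zero integer form `F` of degree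
`1 ≤ d ≤ Δ/M₁` and height `≤ 8Y/c₁` having an irreducible factor `Q₂ ∈ 𝔮'` (degree `1 ≤ a₂ ≤ d`, `(Q₂)` prime): the
satellite lies on a surface of degree `≤ Δ/M₁`, for every `M₁` — its least surface degree is `o(Δ)` in the open kernel.

Proof: Dirichlet's box principle (landed `boxPrinciple`) at degree `d`, height `Y/c₁`; if `F ∉ 𝔮'` then `F ∉ 𝔭`
(landed `envelope_transport`), Nesterenko's PROVED Prop. 4.11 with `r = 1` makes the closest conjugate
`exp(−((binom(d+3,3)−4)/2·Y/c₁ − c_B(d+1))`-close, i.e. within `exp(−(Δh(𝔭) + Y deg 𝔭)/2M)` for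
`M = 24c₁M₁³(8c₁ + c₁³)`, and the landed packaging `pointDatum_of_closeZero` returns the datum (bookkeeping: the landed
`HighSatellite.liouville_exponent_lt`, `smallness_le`, `rateA` with `κ = 1/M₁`); if `F ∈ 𝔮'`, the landed
`exists_primeFactor_mem` gives the factor.

Proofs only: no definitions, no named facts beyond the DISCHARGED Prop. 4.11 / Prop. 4.4. Sources: Nesterenko,
LNM 1752 (2001) Ch. 3 §4 Prop. 4.11 (pp. 40–41); Nesterenko–Philippon (eds.), LNM 1752 Ch. 4 §4 p. 61 (AP2).
-/

set_option linter.dupNamespace false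

noncomputable section

attribute [local instance] MvPolynomial.gradedAlgebra

namespace Summit.Schanuel.Schanuel.Cruxes.ApproximationProperty.OrbitInterpolationDeterminant

open Literature.NumberTheory.Transcendental Literature.NumberTheory.Transcendental.Nesterenko
  Literature.NumberTheory.Transcendental.PhilipponMain MvPolynomial Real
open scoped BigOperators Nat

open HighSatellite in
/-- **Registered stub `pointDatum_or_lowSurface3`** (crux `stmt-Schanuel-6117`, line `orbit-interpolation-determinant`,
skeleton v26): for every `ω ∈ ℂ³`, `c₁ ≥ 1`, `C₄ ≥ c₁` and `M₁ ≥ 64c₁` there are `λ = 8` and `c ≥ c₁` such that at every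
scale `Y ≥ Δ ≥ c`, a datum of the clause-free descent at `(Δ, λY)` whose orbit lies on a rank-2 prime `𝔮' ≤ 𝔭` enveloping
it at level `⌊C₄Δ⌋` yields EITHER a `PointAPAbsAt 3`-datum at `(Δ, Y)` OR a non-zero form `F` of degree `1 ≤ d ≤ Δ/M₁`,
`h(F) ≤ λY/c₁`, with an irreducible factor `Q₂ ∈ 𝔮'` of degree `1 ≤ a₂ ≤ d` generating a prime ideal (module docstring).
[cite: NesterenkoPhilippon2001, Ch. 3 Prop. 4.11 (pp. 40–41); Ch. 4 §4 (p. 61)] -/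
theorem pointDatum_or_lowSurface3 : ∀ (ω : Fin 3 → ℂ) (c₁ : ℝ), 1 ≤ c₁ → ∀ C₄ : ℝ, c₁ ≤ C₄ → ∀ M₁ : ℝ, 64 * c₁ ≤ M₁ → ∃ lam : ℝ, 1 ≤ lam ∧ ∃ c : ℝ, c₁ ≤ c ∧ ∀ Δ Y : ℝ, c ≤ Δ → Δ ≤ Y → ∀ (Q : Rx 3) (a : ℕ) (P : Rx 3) (b : ℕ) (𝔮 : Ideal (Rx 3)) (T : Rx 3) (τ : ℕ) (𝔭 𝔮' : Ideal (Rx 3)), CycleAP3Datum ω c₁ Δ (lam * Y) Q a P b 𝔮 T τ 𝔭 → 𝔮'.IsPrime → IsUnmixedOfRank 𝔮' 2 → 𝔮' ≤ 𝔭 → homogeneousSubmodule (Fin (3 + 1)) ℚ ⌊C₄ * Δ⌋₊ ⊓ 𝔭.restrictScalars ℚ ≤ 𝔮'.restrictScalars ℚ → (∃ (K : Type) (_ : Field K) (_ : NumberField K) (β : Fin 3 → K) (σ : K →+* ℂ), (Module.finrank ℚ K : ℝ) ≤ (c * Δ) ^ 3 ∧ Height.logHeight (Fin.cons (1 : K)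 β : Fin (3 + 1) → K) ≤ c * Y * Δ ^ 2 ∧ ‖(fun j => σ (β j)) - ω‖ ≤ Real.exp (-((Δ * Height.logHeight (Fin.cons (1 : K) β : Fin (3 + 1) → K) + Y * Module.finrank ℚ K) / c))) ∨ (∃ (F Q₂ : Rx 3) (d a₂ : ℕ), F ≠ 0 ∧ F.IsHomogeneous d ∧ 1 ≤ d ∧ (d : ℝ) ≤ Δ / M₁ ∧ height F ≤ lam * Y / c₁ ∧ Q₂ ≠ 0 ∧ Q₂.IsHomogeneous a₂ ∧ 1 ≤ a₂ ∧ a₂ ≤ d ∧ (Ideal.span {Q₂}).IsPrime ∧ Q₂ ∣ F ∧ Q₂ ∈ 𝔮') := by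
  intro ω c₁ hc₁ C₄ hC₄ M₁ hM₁
  classical
  have hc₁0 : 0 < c₁ := by linarith
  have hM₁0 : 0 < M₁ := by linarith
  -- constants at `ω`
  obtain ⟨cB, hcB, hbox₁⟩ := boxPrinciple 3 ω
  obtain ⟨κ, hκdef⟩ : ∃ κ : ℝ, κ = 1 / M₁ := ⟨_, rfl⟩
  have hκ0 : 0 < κ := hκdef ▸ by positivity
  have hκ64 : κ ≤ 1 / (64 * c₁) := by rw [hκdef]; exact one_div_le_one_div_of_le (by positivity) hM₁
  have hκ1 : κ ≤ 1 := hκ64.trans (by rw [div_le_one (by positivity)]; linarith)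
  obtain ⟨r₀, hr₀def⟩ : ∃ r₀ : ℝ, r₀ = κ ^ 3 / 96 := ⟨_, rfl⟩
  have hr₀0 : 0 < r₀ := hr₀def ▸ by positivity
  obtain ⟨M₀, hM₀def⟩ : ∃ M₀ : ℝ, M₀ = 2 * c₁ * (8 * c₁ + c₁ ^ 3) / r₀ := ⟨_, rfl⟩
  have hM₀ : 0 < M₀ := hM₀def ▸ by positivity
  -- the packaging constant (boost `λ = 8`)
  obtain ⟨cP, hcP, hpack⟩ := pointDatum_of_closeZero 3 (by norm_num) stub_zeroDimDictionary ω c₁ 8 M₀ hc₁ (by norm_num) hM₀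
  obtain ⟨c, hcdef⟩ : ∃ c : ℝ, c = cP + ((8 + 6 * c₁ * cB) / r₀ + 1) + 2 / κ := ⟨_, rfl⟩
  have hpos1 : 0 ≤ (8 + 6 * c₁ * cB) / r₀ + 1 := by positivity
  have hpos2 : 0 ≤ 2 / κ := by positivity
  have hcPc : cP ≤ c := by rw [hcdef]; linarith
  have hcP0 : 0 < cP := by linarith
  refine ⟨8, by norm_num, c, hcP.trans hcPc, ?_⟩
  intro Δ Y hΔ hY Q a P b 𝔮 T τ 𝔭 𝔮' hdat h𝔮'p h𝔮'u hle henv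
  -- unpack the datum
  obtain ⟨-, -, -, -, -, -, -, -, -, -, -, -, -, -, -, -, -, -, -, -, -,
    h𝔭p, h𝔭h, h𝔭u, -, -, -, hD, hh, habs⟩ := hdat
  -- scales
  have hcPΔ : cP ≤ Δ := hcPc.trans hΔ
  have hΔ₁ : (8 + 6 * c₁ * cB) / r₀ + 1 ≤ Δ := by rw [hcdef] at hΔ; linarith
  have hκΔ2 : 2 ≤ κ * Δ := by
    have h2 : 2 / κ ≤ Δ := by rw [hcdef] at hΔ; linarith
    rw [div_le_iff₀ hκ0] at h2
    linarith [mul_comm Δ κ]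
  have hΔ1 : 1 ≤ Δ := by linarith
  have hΔ0 : 0 < Δ := by linarith
  have hY0 : 0 < Y := by linarith
  have hD1 : (1 : ℝ) ≤ ideg 𝔭 1 := by
    exact_mod_cast Literature.Barriers.Schanuel.one_le_ideg_of_isPrime
      NesterenkoPhilippon2001_ch3_prop_4_4_holds le_rfl (by norm_num) h𝔭p h𝔭h h𝔭u
  have hh0 : 0 ≤ iheight 𝔭 1 := height_nonneg _
  -- the auxiliary degree `d₁ = ⌊κΔ⌋ = ⌊Δ/M₁⌋`
  obtain ⟨d₁, hd₁def⟩ : ∃ d₁ : ℕ, d₁ = ⌊κ * Δ⌋₊ := ⟨_, rfl⟩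
  have hd₁le : (d₁ : ℝ) ≤ κ * Δ := hd₁def ▸ Nat.floor_le (by positivity)
  have hd₁ge : κ * Δ / 2 ≤ d₁ := by
    have := Nat.lt_floor_add_one (κ * Δ)
    rw [← hd₁def] at this
    linarith
  have hd₁pos : 1 ≤ d₁ := by
    have : (1 : ℝ) ≤ d₁ := by linarith
    exact_mod_cast this
  have hd₁M : (d₁ : ℝ) ≤ Δ / M₁ := by rw [hκdef] at hd₁le; simpa [one_div, div_eq_inv_mul] using hd₁le
  have h2d₁ : 2 * (d₁ : ℝ) ≤ Δ / (32 * c₁) := by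
    calc 2 * (d₁ : ℝ) ≤ 2 * (κ * Δ) := by linarith
      _ ≤ 2 * (1 / (64 * c₁) * Δ) := by gcongr
      _ = Δ / (32 * c₁) := by field_simp; ring
  have h2d₁' : 2 * (d₁ : ℝ) ≤ Δ := h2d₁.trans (div_le_self hΔ0.le (by linarith))
  -- the height scale `N = ⌊e^{Y/c₁}⌋`
  obtain ⟨N, hNdef⟩ : ∃ N : ℕ, N = ⌊Real.exp (Y / c₁)⌋₊ := ⟨_, rfl⟩
  have hN1 : 1 ≤ N := hNdef ▸ Nat.le_floor (by exact_mod_cast Real.one_le_exp (by positivity : 0 ≤ Y / c₁))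
  have hNpos : (0 : ℝ) < N := by exact_mod_cast hN1
  have hlogN : Real.log N ≤ Y / c₁ := by
    calc Real.log N ≤ Real.log (Real.exp (Y / c₁)) :=
          Real.log_le_log hNpos (hNdef ▸ Nat.floor_le (Real.exp_pos _).le)
      _ = Y / c₁ := Real.log_exp _
  have hlogN1 : Y / c₁ ≤ Real.log ((N : ℝ) + 1) := by
    rw [Real.le_log_iff_exp_le (by positivity)]
    exact (hNdef ▸ Nat.lt_floor_add_one (Real.exp (Y / c₁))).le
  have hL0 : 0 ≤ Real.log ((N : ℝ) + 1) := Real.log_nonneg (by linarith)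
  -- a variable outside the satellite; the auxiliary degree sits below the envelope level
  obtain ⟨i, hi⟩ : ∃ i, (X i : Rx 3) ∉ 𝔮' := by
    haveI := h𝔮'p
    refine Literature.RingTheory.MvPolynomial.exists_X_notMem_of_ringKrullDim_ne_zero ?_
    rw [SatelliteRestartGlue.rank_eq_two h𝔮'p h𝔮'u]
    exact_mod_cast (by norm_num : (2 : ℕ) ≠ 0)
  have hlev : d₁ ≤ ⌊C₄ * Δ⌋₊ := by
    refine Nat.le_floor ?_
    have : (d₁ : ℝ) ≤ Δ := by linarith
    exact this.trans (le_mul_of_one_le_left hΔ0.le (hc₁.trans hC₄))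
  -- Step 1: Dirichlet in degree `d₁`
  have h4 : 4 ≤ (d₁ + 3).choose d₁ := by
    rw [Nat.choose_symm_add]
    calc 4 = (1 + 3).choose 3 := by decide
      _ ≤ (d₁ + 3).choose 3 := Nat.choose_le_choose 3 (by omega)
  obtain ⟨F, hF0, hFhom, hF1, -, hFh, hFsmall⟩ := hbox₁ d₁ N ((d₁ + 3).choose d₁) hN1 h4 le_rfl
  have hFh' : height F ≤ Y / c₁ := hFh.trans hlogN
  by_cases hF𝔮' : F ∈ 𝔮'
  · -- the satellite contains an irreducible factor of `F`: the LOW SURFACE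
    obtain ⟨Q₂, a₂, hQ₂0, hQ₂hom, ha₂1, ha₂d, hQ₂prime, hdvd, hQ₂𝔮'⟩ :=
      exists_primeFactor_mem F d₁ 𝔮' hF0 hFhom h𝔮'p hF𝔮'
    refine Or.inr ⟨F, Q₂, d₁, a₂, hF0, hFhom, hd₁pos, hd₁M, ?_, hQ₂0, hQ₂hom, ha₂1, ha₂d, hQ₂prime, hdvd, hQ₂𝔮'⟩
    calc height F ≤ Y / c₁ := hFh'
      _ ≤ 8 * Y / c₁ := by rw [div_le_div_iff_of_pos_right hc₁0]; linarith
  · -- `F ∉ 𝔮'`, hence `F ∉ 𝔭` by the envelope: the closest conjugate is a datum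
    left
    have hF𝔭 : F ∉ 𝔭 := fun hmem => hF𝔮' (mem_of_envelope h𝔮'p hi henv hFhom hlev hmem)
    have hFsmall' : ‖aeval (Fin.cons 1 ω : Fin (3 + 1) → ℂ) F‖ ≤
        Real.exp (cB * (2 * κ * Δ + 1) - (r₀ * Δ ^ 3 - 2) * Real.log ((N : ℝ) + 1)) := by
      refine hFsmall.trans ?_
      rw [Real.exp_le_exp]
      have hC : ((d₁ : ℝ) + 1) ^ 3 ≤ 6 * (((d₁ + 3).choose d₁ : ℕ) : ℝ) := by
        have h' : (d₁ + 1) ^ 3 ≤ 3 ! * (d₁ + 3).choose d₁ :=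
          SmallPrimeHypersurface.succ_pow_le_factorial_mul_choose d₁ 3
        have h'' : (d₁ + 1) ^ 3 ≤ 6 * (d₁ + 3).choose d₁ := by simpa [Nat.factorial] using h'
        exact_mod_cast h''
      have hrate : r₀ * Δ ^ 3 - 2 ≤ ((((d₁ + 3).choose d₁ : ℕ) : ℝ) - 4) / 2 :=
        rateA hC hd₁ge hκ0.le hΔ0.le (le_of_eq hr₀def)
      have e1 : cB * ((d₁ : ℝ) + 1) ≤ cB * (2 * κ * Δ + 1) := mul_le_mul_of_nonneg_left (by linarith) hcB.le
      have e2 := mul_le_mul_of_nonneg_right hrate hL0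
      linarith
    -- Nesterenko's Prop. 4.11 with `r = 1`
    have hω₁0 : (Fin.cons 1 ω : Fin (3 + 1) → ℂ) ≠ 0 := fun h0 => by
      have := congr_fun h0 0
      simp at this
    have h411 := (NesterenkoPhilippon2001_ch3_prop_4_11_holds 3 1 𝔭 F d₁ le_rfl (by norm_num) h𝔭p h𝔭h h𝔭u
      hFhom hd₁pos hF𝔭).2 rfl (Fin.cons 1 ω) hω₁0
    obtain ⟨E, hEdef⟩ : ∃ E : ℝ,
        E = height F * ideg 𝔭 1 + iheight 𝔭 1 * d₁ + 11 * ((3 : ℕ) : ℝ) ^ 2 * ideg 𝔭 1 * d₁ := ⟨_, rfl⟩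
    rw [← hEdef] at h411
    have hdgΔ : (d₁ : ℝ) ≤ Δ / (32 * c₁) := le_trans (by linarith) h2d₁
    have hElt : -((Δ * iheight 𝔭 1 + 8 * Y * ideg 𝔭 1) / c₁) + E < 0 := by
      rw [hEdef]
      push_cast
      exact liouville_exponent_lt hc₁ hΔ0 hY hD1 hh0 hdgΔ hFh'
    have hsmall𝔭 : iabs 𝔭 1 (Fin.cons 1 ω) * Real.exp E < 1 := by
      calc iabs 𝔭 1 (Fin.cons 1 ω) * Real.exp E
          ≤ Real.exp (-((Δ * iheight 𝔭 1 + 8 * Y * ideg 𝔭 1) / c₁)) * Real.exp E :=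
            mul_le_mul_of_nonneg_right habs (Real.exp_pos _).le
        _ = Real.exp (-((Δ * iheight 𝔭 1 + 8 * Y * ideg 𝔭 1) / c₁) + E) := by rw [← Real.exp_add]
        _ < 1 := Real.exp_lt_one_iff.mpr hElt
    have hρlt : rho (Fin.cons 1 ω) 𝔭 < normAt (Fin.cons 1 ω) F := by
      by_contra hcon
      rw [bezoutDelta_of_le (not_lt.mp hcon)] at h411
      exact lt_irrefl _ (lt_of_le_of_lt h411 hsmall𝔭)
    -- the form is that small
    have hX : Δ * iheight 𝔭 1 + Y * ideg 𝔭 1 ≤ (8 * c₁ + c₁ ^ 3) * Y * Δ ^ 3 := by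
      have e1 : Δ * iheight 𝔭 1 ≤ Δ * (c₁ * (8 * Y) * Δ ^ 2) := mul_le_mul_of_nonneg_left hh hΔ0.le
      have e2 : Y * ideg 𝔭 1 ≤ Y * (c₁ * Δ) ^ 3 := mul_le_mul_of_nonneg_left hD hY0.le
      have e3 : Δ * (c₁ * (8 * Y) * Δ ^ 2) + Y * (c₁ * Δ) ^ 3 = (8 * c₁ + c₁ ^ 3) * Y * Δ ^ 3 := by ring
      linarith
    have hnorm : normAt (Fin.cons 1 ω) F ≤ Real.exp (-((Δ * iheight 𝔭 1 + Y * ideg 𝔭 1) / (2 * M₀))) := by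
      have h1 : normAt (Fin.cons 1 ω) F ≤ ‖aeval (Fin.cons 1 ω : Fin (3 + 1) → ℂ) F‖ := by
        unfold normAt
        exact div_le_self (norm_nonneg _)
          (one_le_mul_of_one_le_of_one_le hF1 (one_le_pow₀ (one_le_norm_cons_one ω)))
      have h2 := smallness_le (κ := κ) (L := Real.log ((N : ℝ) + 1)) hr₀0 hcB hκ1 hc₁ hΔ₁ hY hlogN1 hX
      rw [← hM₀def] at h2
      exact h1.trans (hFsmall'.trans (Real.exp_le_exp.mpr h2))
    -- some conjugate is within that distance
    have hne : (projDist (Fin.cons 1 ω : Fin (3 + 1) → ℂ) '' projZeros 𝔭).Nonempty := by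
      obtain ⟨cd, -, hdict⟩ := stub_zeroDimDictionary 3 (by norm_num)
      obtain ⟨K, _i1, _i2, bK, hb0, hzeros, -⟩ := hdict 𝔭 h𝔭p h𝔭h h𝔭u
      obtain ⟨σ₀⟩ := (inferInstance : Nonempty (K →+* ℂ))
      have hz0 : (fun j => σ₀ (bK j)) ≠ 0 := by
        intro h0
        apply hb0
        funext j
        have := congr_fun h0 j
        simpa using this
      have hz : (fun j => σ₀ (bK j)) ∈ projZeros 𝔭 := (hzeros _).mpr ⟨hz0, σ₀, 1, by simp⟩
      exact ⟨_, _, hz, rfl⟩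
    obtain ⟨_, ⟨z, hz, rfl⟩, hzlt⟩ := exists_lt_of_csInf_lt hne hρlt
    have hzle : projDist (Fin.cons 1 ω) z ≤ Real.exp (-((Δ * iheight 𝔭 1 + Y * ideg 𝔭 1) / (2 * M₀))) :=
      (hzlt.trans_le hnorm).le
    -- packaging
    have hh' : iheight 𝔭 1 ≤ c₁ * (8 * Y) * Δ ^ (3 - 1) := by rw [show (3 : ℕ) - 1 = 2 from rfl]; exact hh
    obtain ⟨K, iF, iN, β, σ, hd, hhK, hacc⟩ := hpack Δ Y hcPΔ hY 𝔭 h𝔭p h𝔭h h𝔭u hD hh' z hz hzle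
    refine ⟨K, iF, iN, β, σ, ?_, ?_, ?_⟩
    · exact hd.trans (pow_le_pow_left₀ (by positivity) (mul_le_mul_of_nonneg_right hcPc hΔ0.le) 3)
    · have hhK' : Height.logHeight (Fin.cons (1 : K) β : Fin (3 + 1) → K) ≤ cP * Y * Δ ^ 2 := by
        rw [show (3 : ℕ) - 1 = 2 from rfl] at hhK; exact hhK
      exact hhK'.trans (mul_le_mul_of_nonneg_right (mul_le_mul_of_nonneg_right hcPc hY0.le) (sq_nonneg _))
    · refine hacc.trans ?_
      rw [Real.exp_le_exp, neg_le_neg_iff]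
      exact div_le_div_of_nonneg_left (by positivity) hcP0 hcPc

end Summit.Schanuel.Schanuel.Cruxes.ApproximationProperty.OrbitInterpolationDeterminant

end
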